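import Mathlib.Order.ConditionallyCompleteLattice.Basic
import Literature.AlgebraicGeometry.Frobenioids.PerfFactorial
import Literature.AnabelianGeometry.EtaleTheta.RealificationCoordinates

/-!
# Monoids supported by `ℝ` are complete: coordinates for the target of [EtTh] Lemma 3.5

Source: S. Mochizuki, *The étale theta function …* [MochizukiEtTh2009], Lemma 3.5, PDF pp. 75–76
(printed 301–302), hypothesis (c) "`ℝ` supports `Q`" ([FrdI] Def. 2.4 (ii)(c) [MochizukiFrdI2008]: `Q`
is perfect and perf-factorial and every `Q_𝔭` is `ℝ`-monoprime). The printed proof uses this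
hypothesis through the facts that "`ℝ_{≥0}` acts on `Q`", that each `Q_𝔮 ≅ ℝ_{≥0}`, so that bounded
sums "converge to an element of `Q_𝔮 ≅ ℝ_{≥0}`", and that the factorization homomorphism of `Q`
identifies `Q` with the elements of `Q_factor^rlf = ∏_𝔮 Q_𝔮^rlf` of admissible support ([FrdI]
Def. 2.4 (i)(c),(d)). This file extracts exactly that, stub-free over the tree's `Supports Q .R`:

* `exists_mulEquiv_pfAt`, `isRMonoprime_pfAt`: for perfect `Q` the primes of `Q^pf` are the primes
  of `Q`, so every `Q^pf_𝔮` is `ℝ`-monoprime;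
* `exists_coordinates`: an injective homomorphism `c : Q → ∏_𝔮 ℝ_{≥0}` (the factorization
  homomorphism in coordinates) which is an ORDER EMBEDDING for `≤ = ∣` and whose image is DOWNWARD
  CLOSED;
* consequences: `∣` is antisymmetric on `Q`, `Q` is cancellative, every non-empty bounded subset of
  `Q` has a supremum (`exists_isLUB`), and `Q` is archimedean (`dvd_of_forall_root`).

Proof-only (no definitions). Seat abc-iut-L2-d2 (cell abc-iut, node EtTh:Lem3.5 rlf portion, step 2/4).
-/

namespace Literature.AnabelianGeometry.EtaleTheta

namespace RSupported

open Literature.AlgebraicGeometry.Frobenioids NNReal Function RealificationCoord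

universe u

variable {Q : Type u} [CommMonoid Q]

/-! ### Primes of `Q^pf` versus primes of `Q` for perfect `Q` -/

/-- For a perfect sharp monoid `Q`, every prime `𝔮` of `Q^pf` is the image of a prime `𝔭` of `Q`
under the bijection `Q ≅ Q^pf`, and `Q_𝔭 ≅ Q^pf_𝔮` ([FrdI] §0 p. 12, `Prime(M) ≅ Prime(M^pf)`, in the
case `M = M^pf`). [cite: MochizukiFrdI2008, §0 p.12] -/
theorem exists_mulEquiv_pfAt (hperf : IsPerfect Q) (hsharp : IsSharp Q) (𝔮 : Primes (Perfection Q)) :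
    ∃ 𝔭 : Primes Q, Nonempty (↥𝔭.submonoid ≃* PfAt Q 𝔮) := by
  have hbij := isPerfect_iff_bijective_of.mp hperf
  obtain ⟨⟨x, hx⟩, rfl⟩ := Quotient.mk_surjective 𝔮
  obtain ⟨a, rfl⟩ := hbij.2 x
  have ha : IsPrimary a := (Perfection.isPrimary_of_iff hsharp).mp hx
  let 𝔭 : Primes Q := Quotient.mk (primarySetoid Q) ⟨a, ha⟩
  have hcar : Primes.carrier (Quotient.mk (primarySetoid (Perfection Q)) ⟨Perfection.of Q a, hx⟩) =
      Perfection.of Q '' 𝔭.carrier := by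
    ext y
    constructor
    · rintro ⟨hy, hcls⟩
      obtain ⟨b, rfl⟩ := hbij.2 y
      have hb : IsPrimary b := (Perfection.isPrimary_of_iff hsharp).mp hy
      refine ⟨b, ⟨hb, Quotient.sound ?_⟩, rfl⟩
      have h := Quotient.exact hcls
      exact Perfection.of_precsim_of_iff.mp h
    · rintro ⟨b, ⟨hb, hcls⟩, rfl⟩
      refine ⟨(Perfection.isPrimary_of_iff hsharp).mpr hb, Quotient.sound ?_⟩
      have h := Quotient.exact hcls
      exact Precsim.map (Perfection.of Q) h
  have hsub : Primes.submonoid (Quotient.mk (primarySetoid (Perfection Q)) ⟨Perfection.of Q a, hx⟩) =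
      𝔭.submonoid.map (Perfection.of Q) := by
    rw [Primes.submonoid, Primes.submonoid, MonoidHom.map_mclosure, hcar]
  exact ⟨𝔭, ⟨(Submonoid.equivMapOfInjective 𝔭.submonoid (Perfection.of Q) hbij.1).trans
    (MulEquiv.submonoidCongr hsub.symm)⟩⟩

/-- If `ℝ` supports `Q` then every `Q^pf_𝔮` is `ℝ`-monoprime ("`Q_𝔮 ≅ ℝ_{≥0}`", [EtTh] p. 75).
[cite: MochizukiEtTh2009, Lem 3.5 p.75] -/
theorem isRMonoprime_pfAt (hR : Supports Q MonoidType.R) (𝔮 : Primes (Perfection Q)) :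
    IsRMonoprime (PfAt Q 𝔮) := by
  obtain ⟨hperf, hpf, hRm⟩ := hR
  obtain ⟨𝔭, ⟨e⟩⟩ := exists_mulEquiv_pfAt hperf hpf.isDivisorial.isSharp 𝔮
  obtain ⟨⟨e₀⟩⟩ := hRm 𝔭
  exact ⟨⟨e.symm.trans e₀⟩⟩

/-! ### Coordinates -/

/-- **Coordinates for a monoid supported by `ℝ`.** If `ℝ` supports `Q` ([FrdI] Def. 2.4 (ii)(c)), the
factorization homomorphism `Q = Q^pf ↪ ∏_𝔮 Q^rlf_𝔮 ≅ ∏_𝔮 ℝ_{≥0}` ([FrdI] Def. 2.4 (i)(c)) is an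
injective homomorphism `c` which is an order embedding (`x ∣ y ↔ c x ≤ c y`) with downward closed
image (by Def. 2.4 (i)(d), supports only shrink downwards). This is the form in which [EtTh] Lemma 3.5
uses "`ℝ_{≥0}` acts on `Q`" and "`Q_𝔮 ≅ ℝ_{≥0}`". [cite: MochizukiEtTh2009, Lem 3.5 p.75] -/
theorem exists_coordinates (hR : Supports Q MonoidType.R) :
    ∃ (I : Type u) (c : Q →* (I → Multiplicative ℝ≥0)), Injective c ∧
      (∀ x y : Q, x ∣ y ↔ c x ≤ c y) ∧
      (∀ (s : I → Multiplicative ℝ≥0) (y : Q), s ≤ c y → s ∈ Set.range c) := by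
  have hRlf : ∀ 𝔮 : Primes (Perfection Q), IsRMonoprime (PfAt Q 𝔮) := isRMonoprime_pfAt hR
  obtain ⟨hperf, hpf, -⟩ := hR
  have hbij := isPerfect_iff_bijective_of.mp hperf
  let eQ : Q ≃* Perfection Q := MulEquiv.ofBijective (Perfection.of Q) hbij
  let f : ∀ 𝔮 : Primes (Perfection Q), RlfAt Q 𝔮 ≃* Multiplicative ℝ≥0 :=
    fun 𝔮 => Classical.choice (nonempty_coord (IsMonoprime.ofR (hRlf 𝔮)))
  let Fe : RlfFactor Q ≃* (Primes (Perfection Q) → Multiplicative ℝ≥0) := MulEquiv.piCongrRight f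
  let c : Q →* (Primes (Perfection Q) → Multiplicative ℝ≥0) :=
    (Fe.toMonoidHom.comp hpf.factorHom).comp eQ.toMonoidHom
  have hc : ∀ (x : Q) (𝔮 : Primes (Perfection Q)), c x 𝔮 = f 𝔮 (factorMap Q (eQ x) 𝔮) := fun _ _ => rfl
  -- sharpness of the coordinate monoids
  have hsharp : ∀ 𝔮 : Primes (Perfection Q), IsSharp (RlfAt Q 𝔮) := fun 𝔮 => isSharp_realification _
  refine ⟨Primes (Perfection Q), c, ?_, fun x y => ⟨fun h => ?_, fun h => ?_⟩, fun s y hs => ?_⟩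
  · -- injective
    exact (Fe.injective.comp hpf.factorMap_injective).comp eQ.injective
  · -- `x ∣ y ⇒ c x ≤ c y`
    exact (pi_mnnreal_dvd_iff_le _ _).mp (map_dvd c h)
  · -- `c x ≤ c y ⇒ x ∣ y`: coordinatewise order reflection, then Def. 2.4 (i)(d)
    obtain ⟨xa, hxa⟩ := hpf.factorMap_mem_range (eQ x)
    obtain ⟨xb, hxb⟩ := hpf.factorMap_mem_range (eQ y)
    have hd : ∀ 𝔮 : Primes (Perfection Q), xa 𝔮 ∣ xb 𝔮 := by
      intro 𝔮
      apply dvd_of_coord_le (f 𝔮) (IsMonoprime.ofR (hRlf 𝔮))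
      have h𝔮 := h 𝔮
      rw [hc, hc, ← hxa, ← hxb, pfFactorToRlfFactor_apply, pfFactorToRlfFactor_apply] at h𝔮
      exact h𝔮
    choose d hd using hd
    have hsupp : supp (pfFactorToRlfFactor Q d) ⊆ supp (factorMap Q (eQ y)) := by
      intro 𝔮 h𝔮 hy
      apply h𝔮
      rw [← hxb, pfFactorToRlfFactor_apply, hd 𝔮, map_mul] at hy
      rw [pfFactorToRlfFactor_apply]
      exact (hsharp 𝔮).1 _ (IsUnit.of_mul_eq_one _ (by rwa [mul_comm] at hy))
    obtain ⟨z, hz⟩ := hpf.mem_range_of_supp_subset d (eQ y) hsupp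
    refine ⟨eQ.symm z, eQ.injective ?_⟩
    apply hpf.factorMap_injective
    rw [map_mul, MulEquiv.apply_symm_apply, hpf.factorMap_mul, hz, ← hxa, ← hxb, ← map_mul]
    congr 1
    funext 𝔮
    exact hd 𝔮
  · -- downward closed: `s ≤ c y ⇒ s ∈ range c`
    have hu : ∀ 𝔮 : Primes (Perfection Q), ∃ u : PfAt Q 𝔮, Realification.of _ u = (f 𝔮).symm (s 𝔮) :=
      fun 𝔮 => of_surjective_of_isRMonoprime (hRlf 𝔮) _
    choose u hu using hu
    have hsupp : supp (pfFactorToRlfFactor Q u) ⊆ supp (factorMap Q (eQ y)) := by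
      intro 𝔮 h𝔮 hy
      apply h𝔮
      rw [pfFactorToRlfFactor_apply, hu]
      have hs𝔮 : s 𝔮 ≤ 1 := by
        have := hs 𝔮
        rwa [hc, hy, map_one] at this
      rw [le_antisymm hs𝔮 one_le, map_one]
    obtain ⟨z, hz⟩ := hpf.mem_range_of_supp_subset u (eQ y) hsupp
    refine ⟨eQ.symm z, funext fun 𝔮 => ?_⟩
    rw [hc, MulEquiv.apply_symm_apply, hz, pfFactorToRlfFactor_apply, hu, MulEquiv.apply_symm_apply]

/-! ### Consequences: antisymmetry, cancellation, suprema, archimedean property -/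

/-- If `ℝ` supports `Q`, the order `≤ = ∣` of `Q` is antisymmetric. [cite: MochizukiEtTh2009, Lem 3.5 p.75] -/
theorem dvd_antisymm (hR : Supports Q MonoidType.R) {x y : Q} (h₁ : x ∣ y) (h₂ : y ∣ x) : x = y := by
  obtain ⟨I, c, hinj, hord, -⟩ := exists_coordinates hR
  exact hinj (le_antisymm ((hord x y).mp h₁) ((hord y x).mp h₂))

/-- If `ℝ` supports `Q` then `Q` is cancellative. [cite: MochizukiEtTh2009, Lem 3.5 p.75] -/
theorem mul_left_cancel (hR : Supports Q MonoidType.R) {x y z : Q} (h : x * y = x * z) : y = z := by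
  obtain ⟨I, c, hinj, -, -⟩ := exists_coordinates hR
  apply hinj
  have := congrArg c h
  rw [map_mul, map_mul] at this
  exact _root_.mul_left_cancel this

/-- **Suprema.** If `ℝ` supports `Q`, every non-empty subset of `Q` bounded above (for `∣`) has a least
upper bound ("this sum converges to an element of `Q_𝔮 ≅ ℝ_{≥0}` … this homomorphism factors through
`Q`", [EtTh] p. 75). [cite: MochizukiEtTh2009, Lem 3.5 p.75] -/
theorem exists_isLUB (hR : Supports Q MonoidType.R) (T : Set Q) (hT : T.Nonempty) (w : Q)
    (hw : ∀ t ∈ T, t ∣ w) :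
    ∃ s : Q, (∀ t ∈ T, t ∣ s) ∧ ∀ w' : Q, (∀ t ∈ T, t ∣ w') → s ∣ w' := by
  obtain ⟨I, c, -, hord, hdown⟩ := exists_coordinates hR
  -- pointwise supremum in coordinates
  let S : I → Set ℝ≥0 := fun i => (fun t => Multiplicative.toAdd (c t i)) '' T
  have hSne : ∀ i, (S i).Nonempty := fun i => hT.image _
  have hSbdd : ∀ (i) (w' : Q), (∀ t ∈ T, t ∣ w') → ∀ r ∈ S i, r ≤ Multiplicative.toAdd (c w' i) := by
    rintro i w' hw' _ ⟨t, ht, rfl⟩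
    exact (hord t w').mp (hw' t ht) i
  have hbdd : ∀ i, BddAbove (S i) := fun i => ⟨_, hSbdd i w hw⟩
  let σ : I → Multiplicative ℝ≥0 := fun i => Multiplicative.ofAdd (sSup (S i))
  have hσ : ∀ w' : Q, (∀ t ∈ T, t ∣ w') → σ ≤ c w' := fun w' hw' i =>
    show sSup (S i) ≤ Multiplicative.toAdd (c w' i) from csSup_le (hSne i) (hSbdd i w' hw')
  obtain ⟨s, hs⟩ := hdown σ w (hσ w hw)
  refine ⟨s, fun t ht => (hord t s).mpr ?_, fun w' hw' => (hord s w').mpr ?_⟩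
  · rw [hs]
    intro i
    show Multiplicative.toAdd (c t i) ≤ sSup (S i)
    exact le_csSup (hbdd i) ⟨t, ht, rfl⟩
  · rw [hs]
    exact hσ w' hw'

/-- A nonnegative real below `b + C/n` for every `n ≥ 1` is `≤ b`. [cite: MochizukiFrdI2008, §0 p.10] -/
private theorem nnreal_le_of_forall_le_add_div {a b C : ℝ≥0} (h : ∀ n : ℕ+, a ≤ b + C / n) : a ≤ b := by
  by_contra hab
  replace hab : b < a := not_le.mp hab
  obtain ⟨δ, hδ, hδ'⟩ : ∃ δ : ℝ≥0, 0 < δ ∧ b + δ < a := by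
    refine ⟨(a - b) / 2, by simpa using hab, ?_⟩
    have : b + (a - b) = a := add_tsub_cancel_of_le hab.le
    have h2 : (a - b) / 2 < a - b := NNReal.half_lt_self (ne_of_gt (tsub_pos_of_lt hab))
    calc b + (a - b) / 2 < b + (a - b) := by gcongr
      _ = a := this
  obtain ⟨n, hn⟩ := exists_nat_gt (C / δ)
  have hnpos : 0 < n := by
    rcases Nat.eq_zero_or_pos n with h0 | h0
    · rw [h0, Nat.cast_zero] at hn; exact absurd hn (not_lt.mpr zero_le)
    · exact h0
  have key := h ⟨n, hnpos⟩
  have hCn : C / (n : ℝ≥0) < δ := by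
    rw [div_lt_iff₀ (by exact_mod_cast hnpos)]
    calc C = (C / δ) * δ := (div_mul_cancel₀ C hδ.ne').symm
      _ < n * δ := by gcongr
      _ = δ * n := mul_comm _ _
  have : a < a := calc
    a ≤ b + C / (n : ℝ≥0) := key
    _ < b + δ := by gcongr
    _ < a := hδ'
  exact lt_irrefl _ this

/-- **Archimedean property.** If `ℝ` supports `Q` and `s ≤ s' + c₀/n` for every `n ≥ 1` — precisely: for
every `n` there is an `n`-th root `e` of `c₀` with `s ∣ s' · e` — then `s ∣ s'` (in coordinates:
`a ≤ b + C/n` for all `n` forces `a ≤ b` in `ℝ_{≥0}`). [cite: MochizukiEtTh2009, Lem 3.5 p.75] -/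
theorem dvd_of_forall_root (hR : Supports Q MonoidType.R) {s s' c₀ : Q}
    (h : ∀ n : ℕ+, ∃ e : Q, e ^ (n : ℕ) = c₀ ∧ s ∣ s' * e) : s ∣ s' := by
  obtain ⟨I, c, -, hord, -⟩ := exists_coordinates hR
  refine (hord s s').mpr fun i => ?_
  show Multiplicative.toAdd (c s i) ≤ Multiplicative.toAdd (c s' i)
  apply nnreal_le_of_forall_le_add_div (C := Multiplicative.toAdd (c c₀ i))
  intro n
  obtain ⟨e, he, hse⟩ := h n
  have h1 : Multiplicative.toAdd (c s i) ≤ Multiplicative.toAdd (c s' i) + Multiplicative.toAdd (c e i) := by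
    have := (hord _ _).mp hse i
    rwa [map_mul, Pi.mul_apply] at this
  have h2 : (n : ℝ≥0) * Multiplicative.toAdd (c e i) = Multiplicative.toAdd (c c₀ i) := by
    rw [← he, map_pow, Pi.pow_apply, toAdd_pow, nsmul_eq_mul]
  have hn : (n : ℝ≥0) ≠ 0 := by exact_mod_cast n.pos.ne'
  rw [← h2, mul_div_cancel_left₀ _ hn]
  exact h1

end RSupported

end Literature.AnabelianGeometry.EtaleTheta
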